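import Summits.HodgeConjecture.HodgeConjecture.Theorems.F0P6aModuliDatumDefsReadings   -- ★ previous part of the same Lines workfile `F0_P6a_ModuliDatumDefs` (size-lint split ×4)
import HarnessLib

/-!
# `F0P6aModuliDatumDefsTuples` — ★ RE-HOME of `Lines/F0_P6a_ModuliDatumDefs.lean`, PART 2 of 4 (size-lint split; cut at a declaration boundary).

See PART 1 `Theorems/F0P6aModuliDatumDefsReadings.lean` for the full re-home header and the original module docstring (verbatim there). Namespaces and sections KEPT
(re-opened below exactly as they stand at the cut, with their `open`∕`variable` lines replayed); code bytes = the workfile՚s, docstrings included; options preamble repeated from PART 1.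
HC_CM is proved only modulo the 7 printed citations (2 remaining: hLiu418 = stmt-HodgeConjecture-24832, h413 = stmt-HodgeConjecture-24833) until rung 0 closes; a re-home is count-neutral. -/

namespace Summit.HodgeConjecture.HodgeConjecture.Cruxes.HLiu418.F0P6aModuliDatumDefs
set_option linter.dupNamespace false  -- `Summit.HodgeConjecture.HodgeConjecture.…` BY DESIGN (D-0017)
open CategoryTheory NumberField IsDedekindDomain MulAction
open scoped Matrix
open Literature.NumberTheory.GaloisRepresentations
open Literature.NumberTheory.Automorphic Literature.NumberTheory.Automorphic.UnitaryGroup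
open Literature.AlgebraicGeometry.ShimuraVarieties.UnitaryCanonicalModel
open Literature.NumberTheory.Automorphic.Liu2021.AppendixC
open Literature.AlgebraicGeometry.Motives (AlgPoints IntegralModel frobeniusOver SchemeOver thickening thickeningGalAction thickeningLift)
open Literature.NumberTheory.DiophantineGeometry (geomResidueField specialFibreFunctor)
open Literature.AlgebraicGeometry.RelativeSpec (ActionOver)
open Literature.NumberTheory.EllipticCurves (genericFibre)
open AlgebraicGeometry (QuasiCompact QuasiSeparated LocallyOfFinitePresentation Flat IsSeparated SmoothOfRelativeDimension)
open Summit.HodgeConjecture.HodgeConjecture.Cruxes.HLiu418.F0P6cIsogenyDictionary (PointDictionary)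
open scoped Pointwise
open scoped MonoidalCategory Polynomial
open Literature.AlgebraicGeometry.Motives (specOver relFrobeniusOver frobeniusTwistOver frobSpec)
open Literature.AlgebraicGeometry.GroupSchemes.AffineGroupScheme (Alg quotIncl)
open Summit.HodgeConjecture.HodgeConjecture.Cruxes.HLiu418.F0P6cDictConstructors (kerFI AdmSub IdealIsEtale)


/-! ### §1‴ LAYER (ii-3)∕(ii-4) helpers (desk g1, v0.4): the generic-fibre tuple as an abelian SCHEME over `Spec Ω`, ideal torsion upstairs, level points on the
fibre, and the ISOGENY-ROOF READING of the Hecke translates D4 `quotΩ` ∕ D7 `translΩ` (LEAD M-17c D-2 «=»: Serre-tensor ∕ roof form, EXACT `λ`, no global uniformiser; ref1 n30) -/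

/-- (ii-3) helper: the generic fibre at `y` as an abelian SCHEME over `Spec Ω` — the ITERATED base change `(𝒜 ×_𝓨 Y) ×_Y Spec Ω` along `ι_η` then the point
`thickeningLift e (S.M.obj Kc) y`, so that `fibreΩOf … 𝒜 y = (schΩOf … 𝒜 y).toAffine.toAbelianVariety` ON THE NOSE (★ `fibre`); the carrier on which ★ `DualPair.baseChange`, ★
`Polarization.baseChange`, ★ `DualPair.dualIsogenyOver` and ★ `mulN` are stated. [cite: MumfordFogartyKirwan1994, Ch. 6 §1 (p. 115)] -/
noncomputable abbrev schΩOf {F : Type} [Field F] [NumberField F] [IsCMField F] {ι₁ : F →+* ℂ} {Jstar : Matrix (Fin 2) (Fin 2) F}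
    {K₀ : C5.OpenCompactSubgroup ↥(finAdelic ↥(maximalRealSubfield F) F (IsCMField.complexConj F) 2 Jstar)}
    (S : RecordSystemGS F Jstar ι₁ K₀) {Fi : Type} [Field Fi] [Algebra F Fi] (Kc : C5.SmallLevel K₀)
    (𝓜 : IntegralModel (𝓞 F) F ((thickening F Fi).obj (S.M.obj Kc))) (w : HeightOneSpectrum (𝓞 F))
    (e : Fi →ₐ[F] AlgebraicClosure (w.adicCompletion F))
    (𝒜 : Literature.AlgebraicGeometry.AbelianSchemes.AbelianSchemeOver (𝓜.localise w).total.left)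
    (y : AlgPoints (S.M.obj Kc) (AlgebraicClosure (w.adicCompletion F))) :
    Literature.AlgebraicGeometry.AbelianSchemes.AbelianSchemeOver (AlgebraicGeometry.Spec (CommRingCat.of (AlgebraicClosure (w.adicCompletion F)))) :=
  (𝒜.baseChange
      ((𝓜.localise w).genericIso'.inv.left ≫
        CategoryTheory.Limits.pullback.fst (𝓜.localise w).total.hom
          (Literature.NumberTheory.EllipticCurves.specGenericPoint (HeightOneSpectrum.valuationSubringAtPrime F w) F))).baseChange
    (thickeningLift e (S.M.obj Kc) y).left

/-- (ii-3) helper: the dual pair `(Â_y, 𝒫_y)` of the generic fibre at `y` (★ `DualPair.baseChange`, twice). [cite: MumfordFogartyKirwan1994, Ch. 6 §1 (p. 115)] -/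
noncomputable abbrev dualΩOf {F : Type} [Field F] [NumberField F] [IsCMField F] {ι₁ : F →+* ℂ} {Jstar : Matrix (Fin 2) (Fin 2) F}
    {K₀ : C5.OpenCompactSubgroup ↥(finAdelic ↥(maximalRealSubfield F) F (IsCMField.complexConj F) 2 Jstar)}
    (S : RecordSystemGS F Jstar ι₁ K₀) {Fi : Type} [Field Fi] [Algebra F Fi] (Kc : C5.SmallLevel K₀)
    (𝓜 : IntegralModel (𝓞 F) F ((thickening F Fi).obj (S.M.obj Kc))) (w : HeightOneSpectrum (𝓞 F))
    (e : Fi →ₐ[F] AlgebraicClosure (w.adicCompletion F))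
    (𝒜 : Literature.AlgebraicGeometry.AbelianSchemes.AbelianSchemeOver (𝓜.localise w).total.left)
    (D : 𝒜.DualPair) (y : AlgPoints (S.M.obj Kc) (AlgebraicClosure (w.adicCompletion F))) : (schΩOf S Kc 𝓜 w e 𝒜 y).DualPair :=
  (D.baseChange
      ((𝓜.localise w).genericIso'.inv.left ≫
        CategoryTheory.Limits.pullback.fst (𝓜.localise w).total.hom
          (Literature.NumberTheory.EllipticCurves.specGenericPoint (HeightOneSpectrum.valuationSubringAtPrime F w) F))).baseChange
    (thickeningLift e (S.M.obj Kc) y).left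

/-- (ii-3) helper: the polarisation `λ_y : A_y → Â_y` of the generic fibre at `y` (★ `Polarization.baseChange`, twice; EXACT, no scalar). [cite: MumfordFogartyKirwan1994, Ch. 6 §2 Definition 6.3 (p. 120)] -/
noncomputable abbrev polΩOf {F : Type} [Field F] [NumberField F] [IsCMField F] {ι₁ : F →+* ℂ} {Jstar : Matrix (Fin 2) (Fin 2) F}
    {K₀ : C5.OpenCompactSubgroup ↥(finAdelic ↥(maximalRealSubfield F) F (IsCMField.complexConj F) 2 Jstar)}
    (S : RecordSystemGS F Jstar ι₁ K₀) {Fi : Type} [Field Fi] [Algebra F Fi] (Kc : C5.SmallLevel K₀)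
    (𝓜 : IntegralModel (𝓞 F) F ((thickening F Fi).obj (S.M.obj Kc))) (w : HeightOneSpectrum (𝓞 F))
    (e : Fi →ₐ[F] AlgebraicClosure (w.adicCompletion F))
    (𝒜 : Literature.AlgebraicGeometry.AbelianSchemes.AbelianSchemeOver (𝓜.localise w).total.left)
    {D : 𝒜.DualPair} (pol : 𝒜.Polarization D) (y : AlgPoints (S.M.obj Kc) (AlgebraicClosure (w.adicCompletion F))) :
    (schΩOf S Kc 𝓜 w e 𝒜 y).Polarization (dualΩOf S Kc 𝓜 w e 𝒜 D y) :=
  (pol.baseChange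
      ((𝓜.localise w).genericIso'.inv.left ≫
        CategoryTheory.Limits.pullback.fst (𝓜.localise w).total.hom
          (Literature.NumberTheory.EllipticCurves.specGenericPoint (HeightOneSpectrum.valuationSubringAtPrime F w) F))).baseChange
    (thickeningLift e (S.M.obj Kc) y).left

/-- (ii-3) helper: the level point `σ^a(y) ∈ A_y(Ω)` of a level-`N` structure, read on the generic fibre at `y` (★ `LevelStructure.baseChange`, ★ `section_`, ★ `restrictPt` — the
`Motives.AlgPoints` currency of `fibreΩOf`). [cite: MumfordFogartyKirwan1994, Ch. 7 §2 Definition 7.1 (p. 129)] -/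
noncomputable def lvlPtΩOf {F : Type} [Field F] [NumberField F] [IsCMField F] {ι₁ : F →+* ℂ} {Jstar : Matrix (Fin 2) (Fin 2) F}
    {K₀ : C5.OpenCompactSubgroup ↥(finAdelic ↥(maximalRealSubfield F) F (IsCMField.complexConj F) 2 Jstar)}
    (S : RecordSystemGS F Jstar ι₁ K₀) {Fi : Type} [Field Fi] [Algebra F Fi] (Kc : C5.SmallLevel K₀)
    (𝓜 : IntegralModel (𝓞 F) F ((thickening F Fi).obj (S.M.obj Kc))) (w : HeightOneSpectrum (𝓞 F))
    (e : Fi →ₐ[F] AlgebraicClosure (w.adicCompletion F))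
    (𝒜 : Literature.AlgebraicGeometry.AbelianSchemes.AbelianSchemeOver (𝓜.localise w).total.left)
    {g N : ℕ} (lvl : 𝒜.LevelStructure g N) (y : AlgPoints (S.M.obj Kc) (AlgebraicClosure (w.adicCompletion F))) (a : Fin g ⊕ Fin g → ZMod N) :
    (fibreΩOf S Kc 𝓜 w e 𝒜 y).Points (AlgebraicClosure (w.adicCompletion F)) :=
  (𝒜.baseChange
      ((𝓜.localise w).genericIso'.inv.left ≫
        CategoryTheory.Limits.pullback.fst (𝓜.localise w).total.hom
          (Literature.NumberTheory.EllipticCurves.specGenericPoint (HeightOneSpectrum.valuationSubringAtPrime F w) F))).restrictPt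
    (thickeningLift e (S.M.obj Kc) y).left
    ((lvl.baseChange
      ((𝓜.localise w).genericIso'.inv.left ≫
        CategoryTheory.Limits.pullback.fst (𝓜.localise w).total.hom
          (Literature.NumberTheory.EllipticCurves.specGenericPoint (HeightOneSpectrum.valuationSubringAtPrime F w) F))).section_ a)

/-- (ii-3) helper: the `Ω`-point `P` of the generic fibre at `y` is KILLED BY THE IDEAL `𝔞 ⊆ 𝒪_F` (`ι(a)_y P = 1` for all `a ∈ 𝔞`) — the points of `A_y[𝔞](Ω)`; the generic
twin of `IsIdealTorsion₀`. [cite: Kottwitz1992, §5, p. 390] -/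
def IsIdealTorsionΩ {F : Type} [Field F] [NumberField F] [IsCMField F] {ι₁ : F →+* ℂ} {Jstar : Matrix (Fin 2) (Fin 2) F}
    {K₀ : C5.OpenCompactSubgroup ↥(finAdelic ↥(maximalRealSubfield F) F (IsCMField.complexConj F) 2 Jstar)}
    (S : RecordSystemGS F Jstar ι₁ K₀) {Fi : Type} [Field Fi] [Algebra F Fi] (Kc : C5.SmallLevel K₀)
    (𝓜 : IntegralModel (𝓞 F) F ((thickening F Fi).obj (S.M.obj Kc))) (w : HeightOneSpectrum (𝓞 F))
    (e : Fi →ₐ[F] AlgebraicClosure (w.adicCompletion F))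
    (𝒜 : Literature.AlgebraicGeometry.AbelianSchemes.AbelianSchemeOver (𝓜.localise w).total.left)
    (ρ : Literature.AlgebraicGeometry.AbelianSchemes.AbelianSchemeOver.RingAction (𝓞 F) 𝒜)
    (y : AlgPoints (S.M.obj Kc) (AlgebraicClosure (w.adicCompletion F))) (𝔞 : Ideal (𝓞 F))
    (P : (fibreΩOf S Kc 𝓜 w e 𝒜 y).Points (AlgebraicClosure (w.adicCompletion F))) : Prop :=
  ∀ a ∈ 𝔞, (AlgPoints.map (actΩOf S Kc 𝓜 w e 𝒜 ρ a y).hom.hom.hom P : (fibreΩOf S Kc 𝓜 w e 𝒜 y).Points (AlgebraicClosure (w.adicCompletion F))) = 1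

set_option maxHeartbeats 400000 in
/-- (ii-4) helper — **THE ISOGENY ROOF `A_y —q→ B ←c— A_y″` READING A HECKE TRANSLATE** (LEAD M-17c D-2; ref1 n30; desk g1 lattice check): for a tuple
`(𝒜, ι, (Â, 𝒫), λ, level-N)` over `𝓨`, two record points `y, y″ ∈ M⋆_{Kc}(Ω)`, a finite subgroup `K ≤ A_y(Ω)`, an ideal `𝔞` and a prime `p`: there are an abelian
scheme `B ∕ Spec Ω` with a dual pair and a homomorphism `λ_B : B → B̂`, and HOMOMORPHISMS `q : A_y → B`, `c : A_y″ → B` such that (r1) `Ker q(Ω) = K`; (r2)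
`Ker c(Ω) = A_y″[𝔞](Ω)` and `c` is surjective (so `A_y″ ≅ B ⊗_𝒪 𝔞`, SERRE); (r3) `q^*λ_B = p·λ_y` and `c^*λ_B = p·λ_y″` (★ `dualIsogenyOver`, ★ `mulN`: the
polarisations correspond EXACTLY under the quasi-isogeny `c⁻¹q`, NO similitude factor — `λ_B` is the descent of `p·λ_y`, never a `ϖ`); (r4) `q`, `c` are
`𝒪_F`-equivariant for a common endomorphism of `B`; (r5) the level-`N` points correspond: `q(σ^a(y)) = c(σ^a(y″))` (`p ∤ N`).  LATTICE CHECK (`F_w` of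
any ramification ∕ degree): with `K = H_L ⊕ H_L^⊥` this says `T(A_y″) = 𝔭_w·(T(A_y) + p⁻¹K̃)`, self-dual for the SAME `λ`, i.e. the index-`q` sub-at-`w` ∕
super-at-`c•w` neighbour = the right-`t₁(w)`-translate (K-TEST «t₁», LEAD M-16 (2)); with `K = A_y[𝔭_{c•w}]` it is the central translate `⟨ϖ⟩` (`T ↦ 𝔭_w𝔭_{c•w}⁻¹·T`).
Pairing-free: the isotropy of `K` is FORCED by (r3).  GEN RECIPE (A-p03 (g30) R6 census §1, LEAD «=» 21:58:00Z (B); Defs ED. 3 collector): realise the middle object as the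
FIBRE OF A FAMILY — `B := fibreΩOf … 𝒞 y″` for the Serre-tensor family `𝒞 := serreTensor (univ, act) E_{𝔭_w⁻¹}` (★ `AbelianSchemes/SerreTensorConstruction`), `c :=` the Serre
cover of that family read on the fibre (★ `fibreHom_serreTranslateInv_eq`, `AbelianSchemes/SerreTensorCoverBaseChange`), `lamB := (λ_𝒞)_{y″}` — so that only `q` and the `b_a`
are point-wise data and the reduction `RoofΩ → Roof₀` runs through ★ (ν7) `exists_stage_hom_reduction_turnkey` (`AbelianSchemes/AbelianSchemeHomReductionTurnkey`).
[cite: MumfordAV1970, §23 Thm. 2 p. 231; §15 Thm. 1 p. 143] [cite: RapoportSmithlingZhang2020Diagonal, §4.1 p. 17, §4.3 (4.23) p. 21] [cite: Kottwitz1992, §5, p. 391] -/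
def RoofΩ {F : Type} [Field F] [NumberField F] [IsCMField F] {ι₁ : F →+* ℂ} {Jstar : Matrix (Fin 2) (Fin 2) F}
    {K₀ : C5.OpenCompactSubgroup ↥(finAdelic ↥(maximalRealSubfield F) F (IsCMField.complexConj F) 2 Jstar)}
    (S : RecordSystemGS F Jstar ι₁ K₀) {Fi : Type} [Field Fi] [Algebra F Fi] (Kc : C5.SmallLevel K₀)
    (𝓜 : IntegralModel (𝓞 F) F ((thickening F Fi).obj (S.M.obj Kc))) (w : HeightOneSpectrum (𝓞 F))
    (e : Fi →ₐ[F] AlgebraicClosure (w.adicCompletion F))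
    (𝒜 : Literature.AlgebraicGeometry.AbelianSchemes.AbelianSchemeOver (𝓜.localise w).total.left)
    (ρ : Literature.AlgebraicGeometry.AbelianSchemes.AbelianSchemeOver.RingAction (𝓞 F) 𝒜)
    (D : 𝒜.DualPair) (pol : 𝒜.Polarization D) {g N : ℕ} (lvl : 𝒜.LevelStructure g N) (pChar : ℕ) (𝔞 : Ideal (𝓞 F))
    (y y'' : AlgPoints (S.M.obj Kc) (AlgebraicClosure (w.adicCompletion F)))
    (K : Subgroup ((fibreΩOf S Kc 𝓜 w e 𝒜 y).Points (AlgebraicClosure (w.adicCompletion F)))) : Prop :=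
  ∃ (B : Literature.AlgebraicGeometry.AbelianSchemes.AbelianSchemeOver (AlgebraicGeometry.Spec (CommRingCat.of (AlgebraicClosure (w.adicCompletion F)))))
    (DB : B.DualPair) (lamB : B.X ⟶ DB.hat.X) (_ : IsMonHom lamB)
    -- J12 INTERFACE PIN (ref1 (g2) e-12): `B̂`'s Poincaré sheaf is normalised along `A × {ε_B̂}` — the unit clause `hD_B` (for a ★ `Polarization` it is ★ `Polarization.nonempty_unitHatSlice_iso`)
    (_ : Nonempty ((AlgebraicGeometry.Scheme.Modules.pullback DB.unitHatSlice).obj DB.P ≅ SheafOfModules.unit _))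
    (q : (schΩOf S Kc 𝓜 w e 𝒜 y).X ⟶ B.X) (_ : IsMonHom q)
    (c : (schΩOf S Kc 𝓜 w e 𝒜 y'').X ⟶ B.X) (_ : IsMonHom c),
    -- (r1) kernel of `q` on `Ω`-points
    (∀ P : (fibreΩOf S Kc 𝓜 w e 𝒜 y).Points (AlgebraicClosure (w.adicCompletion F)),
        (AlgPoints.map q P : B.toAffine.toAbelianVariety.Points (AlgebraicClosure (w.adicCompletion F))) = 1 ↔ P ∈ K) ∧
    -- (r2) kernel of `c` on `Ω`-points = the `𝔞`-torsion; `c` surjective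
    (∀ P : (fibreΩOf S Kc 𝓜 w e 𝒜 y'').Points (AlgebraicClosure (w.adicCompletion F)),
        (AlgPoints.map c P : B.toAffine.toAbelianVariety.Points (AlgebraicClosure (w.adicCompletion F))) = 1 ↔
          IsIdealTorsionΩ S Kc 𝓜 w e 𝒜 ρ y'' 𝔞 P) ∧
    Function.Surjective c.left.base ∧
    -- (r3) polarisations: `q^* λ_B = p • λ_y`, `c^* λ_B = p • λ_y″`
    q ≫ lamB ≫ Literature.AlgebraicGeometry.AbelianSchemes.AbelianSchemeOver.DualPair.dualIsogenyOver q (dualΩOf S Kc 𝓜 w e 𝒜 D y) DB =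
      (polΩOf S Kc 𝓜 w e 𝒜 pol y).lam ≫ (dualΩOf S Kc 𝓜 w e 𝒜 D y).hat.mulN pChar ∧
    c ≫ lamB ≫ Literature.AlgebraicGeometry.AbelianSchemes.AbelianSchemeOver.DualPair.dualIsogenyOver c (dualΩOf S Kc 𝓜 w e 𝒜 D y'') DB =
      (polΩOf S Kc 𝓜 w e 𝒜 pol y'').lam ≫ (dualΩOf S Kc 𝓜 w e 𝒜 D y'').hat.mulN pChar ∧
    -- (r4) `𝒪_F`-equivariance through a common endomorphism of `B`
    (∀ a : 𝓞 F, ∃ b : B.X ⟶ B.X,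
        (actΩOf S Kc 𝓜 w e 𝒜 ρ a y).hom.hom.hom ≫ q = q ≫ b ∧ (actΩOf S Kc 𝓜 w e 𝒜 ρ a y'').hom.hom.hom ≫ c = c ≫ b) ∧
    -- (r5) level-`N` points correspond
    (∀ a : Fin g ⊕ Fin g → ZMod N,
        (AlgPoints.map q (lvlPtΩOf S Kc 𝓜 w e 𝒜 lvl y a) : B.toAffine.toAbelianVariety.Points (AlgebraicClosure (w.adicCompletion F))) =
          AlgPoints.map c (lvlPtΩOf S Kc 𝓜 w e 𝒜 lvl y'' a))

set_option maxHeartbeats 400000 in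
/-- (ii-5) helper — **THE SERRE COVER `c : A_{e,y} → A_{e∘γ,y}` READING THE TWIST BETWEEN TWO GENERIC SHEETS** (cover orientation, desk g1; LEAD M-16 (2), M-17c): for a
tuple `(𝒜, ι, (Â, 𝒫), λ, level-N)` over `𝓨`, a record point `y`, the two readings `ℓ_e y` and `ℓ_{e∘γ} y` of `y` on the generic sheets `e` and `e∘γ`, an ideal `𝔞 ⊆ 𝒪_F`
and `n ∈ ℕ`: «`𝒯(ℓ_e y) ≅ 𝒯(ℓ_{e∘γ} y) ⊗_{𝒪_F} 𝔞`, EXACTLY» — there is a HOMOMORPHISM `c : A_{e,y} → A_{e∘γ,y}` with (t1) the SERRE PRESENTATION «for `a ∈ 𝔞` some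
`d_a : A_{e∘γ,y} → A_{e,y}` has `c ∘? …`: `c ≫ d_a = ι_{e,y}(a)` and `d_a ≫ c = ι_{e∘γ,y}(a)`» (so `𝔞·T(A_{e∘γ,y}) ⊆ T(A_{e,y}) ⊆ T(A_{e∘γ,y})`, `c`, `d_a` isogenies);
(t2) the UPPER BOUND «for `b ∈ 𝔞̄` some `f_b` has `c ≫ ι_{e∘γ,y}(b) = f_b ≫ ι_{e∘γ,y}(n)`» (so `𝔞̄·T(A_{e,y}) ⊆ n·T(A_{e∘γ,y})`, i.e. with `(n) = 𝔞𝔞̄`: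
`T(A_{e,y}) = 𝔞·T(A_{e∘γ,y})` on the nose — pairing-free, point-free); (t3) `c^*λ_{e∘γ,y} = n·λ_{e,y}` (★ `dualIsogenyOver`, ★ `mulN`; EXACT twisted polarisation
`n⁻¹E` on `𝔞T`); (t4) `𝒪_F`-equivariance; (t5) `c(σ^a(ℓ_e y)) = σ^a(ℓ_{e∘γ} y)` (canonical level transport, `𝔞 ⊥ N`).  The orientation is the one FORCED by
the Frobenius shape of the twist ideal («`w`-part of `𝔞_{γ_σ}` = `𝔭_w^{d_w}`», HEART-FROB.md §E; v0.5: `frob₀.frobIdeal_spec`): with `σ ∘ e = e ∘ γ_σ`, `𝒯(ℓ_e y)^σ = 𝒯(ℓ_{e∘γ_σ}(σ•y))` and `𝒯(ℓ_e(σ•y)) = 𝒯(ℓ_e y)^σ ⊗ 𝔞_{γ_σ}`,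
reducing to `A_z̄^{(q)} ⊗ 𝔞_{γ_σ} = (A_z̄ ∕ Ker F_q) ⊗ 𝔞_{γ_σ}` (A-p06 ★ `IsExactTwistPol` is the same law read with `𝔟 = 𝔞̄·n⁻¹ ∋ 1`).
[cite: Shimura1998, §13.1, Theorem 1; §18.6] [cite: Conrad2004GrossZagier, §7, Thm. 7.6] [cite: RapoportSmithlingZhang2020Diagonal, §3.2 p. 11, §4.3 p. 20] -/
def CoverΩ {F : Type} [Field F] [NumberField F] [IsCMField F] {ι₁ : F →+* ℂ} {Jstar : Matrix (Fin 2) (Fin 2) F}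
    {K₀ : C5.OpenCompactSubgroup ↥(finAdelic ↥(maximalRealSubfield F) F (IsCMField.complexConj F) 2 Jstar)}
    (S : RecordSystemGS F Jstar ι₁ K₀) {Fi : Type} [Field Fi] [Algebra F Fi] (Kc : C5.SmallLevel K₀)
    (𝓜 : IntegralModel (𝓞 F) F ((thickening F Fi).obj (S.M.obj Kc))) (w : HeightOneSpectrum (𝓞 F))
    (e : Fi →ₐ[F] AlgebraicClosure (w.adicCompletion F))
    (𝒜 : Literature.AlgebraicGeometry.AbelianSchemes.AbelianSchemeOver (𝓜.localise w).total.left)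
    (ρ : Literature.AlgebraicGeometry.AbelianSchemes.AbelianSchemeOver.RingAction (𝓞 F) 𝒜)
    (D : 𝒜.DualPair) (pol : 𝒜.Polarization D) {g N : ℕ} (lvl : 𝒜.LevelStructure g N)
    (e' : Fi →ₐ[F] AlgebraicClosure (w.adicCompletion F)) (𝔞 : Ideal (𝓞 F)) (n : ℕ)
    (y : AlgPoints (S.M.obj Kc) (AlgebraicClosure (w.adicCompletion F))) : Prop :=
  ∃ (c : (schΩOf S Kc 𝓜 w e 𝒜 y).X ⟶ (schΩOf S Kc 𝓜 w e' 𝒜 y).X) (_ : IsMonHom c),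
    -- (t1) Serre presentation of `𝔞`
    (∀ a ∈ 𝔞, ∃ d : (schΩOf S Kc 𝓜 w e' 𝒜 y).X ⟶ (schΩOf S Kc 𝓜 w e 𝒜 y).X,
        c ≫ d = (actΩOf S Kc 𝓜 w e 𝒜 ρ a y).hom.hom.hom ∧ d ≫ c = (actΩOf S Kc 𝓜 w e' 𝒜 ρ a y).hom.hom.hom) ∧
    -- (t2) upper bound through `𝔞̄` and `(n) = 𝔞𝔞̄`
    (∀ b ∈ (IsCMField.complexConj F) • 𝔞, ∃ f : (schΩOf S Kc 𝓜 w e 𝒜 y).X ⟶ (schΩOf S Kc 𝓜 w e' 𝒜 y).X,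
        c ≫ (actΩOf S Kc 𝓜 w e' 𝒜 ρ b y).hom.hom.hom = f ≫ (actΩOf S Kc 𝓜 w e' 𝒜 ρ (n : 𝓞 F) y).hom.hom.hom) ∧
    -- (t3) polarisations: `c^* λ_{e',y} = n • λ_{e,y}`
    c ≫ (polΩOf S Kc 𝓜 w e' 𝒜 pol y).lam ≫
        Literature.AlgebraicGeometry.AbelianSchemes.AbelianSchemeOver.DualPair.dualIsogenyOver c
          (dualΩOf S Kc 𝓜 w e 𝒜 D y) (dualΩOf S Kc 𝓜 w e' 𝒜 D y) =
      (polΩOf S Kc 𝓜 w e 𝒜 pol y).lam ≫ (dualΩOf S Kc 𝓜 w e 𝒜 D y).hat.mulN n ∧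
    -- (t4) `𝒪_F`-equivariance
    (∀ a : 𝓞 F, (actΩOf S Kc 𝓜 w e 𝒜 ρ a y).hom.hom.hom ≫ c = c ≫ (actΩOf S Kc 𝓜 w e' 𝒜 ρ a y).hom.hom.hom) ∧
    -- (t5) level-`N` points
    (∀ a : Fin g ⊕ Fin g → ZMod N,
        (AlgPoints.map c (lvlPtΩOf S Kc 𝓜 w e 𝒜 lvl y a) :
            (fibreΩOf S Kc 𝓜 w e' 𝒜 y).Points (AlgebraicClosure (w.adicCompletion F))) = lvlPtΩOf S Kc 𝓜 w e' 𝒜 lvl y a)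

set_option maxHeartbeats 400000 in
/-- (ii-5) **THE TWIST READING BETWEEN GENERIC SHEETS** (v0.3θ–v0.4: the `ModuliDatum` field `twistΩ`; since v0.5 (M-17r TOKEN = DROP) GEN՚s typed VOCABULARY for proving `frob₀.frob₀_cover` by reduction, not a field): for the two tuples `(𝒜, ι, Â, λ, lvl)` and `(𝒜₀, ι₀, Â₀, λ₀, lvl₀)`
over `𝓨` and the twist ideals `𝔞_γ`: NORMS `n_γ` with `(n_γ) = 𝔞_γ·𝔞̄_γ` (relative type norms — what makes the twisted polarisation `n_γ⁻¹E` on `𝔞_γT` EXACT), `𝔞_γ`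
PRIME TO THE LEVEL `N` (ray-class choice by weak approximation ⇒ the level transport is canonical), and the SERRE COVERS (helper `CoverΩ`, cover orientation)
`𝒯(ℓ_e y) ≅ 𝒯(ℓ_{e∘γ} y) ⊗_{𝒪_F} 𝔞_γ` and `𝒯₀(ℓ_e y) ≅ 𝒯₀(ℓ_{e∘γ} y) ⊗_{𝒪_F} 𝔞_γ` with the SAME ideal and norm (`Hom_{𝒪_F}(A₀, A)` is sheet-independent).  Why it might
fail: GEN՚s `θ` may realise the inverse convention — absorbed by the free field `twistIdeal` (`𝔞 ↦ 𝔞̄`) except that `frob₀.frobIdeal_spec` pins the `w`-part (J-row «TWIST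
ORIENTATION», HEART-FROB.md §E).  A `Type`-valued record (the norms are data); NOTHING is asserted by declaring it.
[cite: Shimura1998, §13.1, Theorem 1; §18.6] [cite: RapoportSmithlingZhang2020Diagonal, §3.2 p. 11, §4.3 p. 20] [cite: MumfordFogartyKirwan1994, Ch. 7 §2 Definition 7.1 (p. 129)] -/
structure TwistReadingΩ {F : Type} [Field F] [NumberField F] [IsCMField F] {ι₁ : F →+* ℂ} {Jstar : Matrix (Fin 2) (Fin 2) F}
    {K₀ : C5.OpenCompactSubgroup ↥(finAdelic ↥(maximalRealSubfield F) F (IsCMField.complexConj F) 2 Jstar)}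
    (S : RecordSystemGS F Jstar ι₁ K₀) {Fi : Type} [Field Fi] [Algebra F Fi] (Kc : C5.SmallLevel K₀)
    (𝓜 : IntegralModel (𝓞 F) F ((thickening F Fi).obj (S.M.obj Kc))) (w : HeightOneSpectrum (𝓞 F))
    (e : Fi →ₐ[F] AlgebraicClosure (w.adicCompletion F))
    (𝒜 : Literature.AlgebraicGeometry.AbelianSchemes.AbelianSchemeOver (𝓜.localise w).total.left)
    (ρ : Literature.AlgebraicGeometry.AbelianSchemes.AbelianSchemeOver.RingAction (𝓞 F) 𝒜)
    (D : 𝒜.DualPair) (pol : 𝒜.Polarization D) {g N' : ℕ} (lvl : 𝒜.LevelStructure g N')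
    (𝒜₀ : Literature.AlgebraicGeometry.AbelianSchemes.AbelianSchemeOver (𝓜.localise w).total.left)
    (ρ₀ : Literature.AlgebraicGeometry.AbelianSchemes.AbelianSchemeOver.RingAction (𝓞 F) 𝒜₀)
    (D₀ : 𝒜₀.DualPair) (pol₀ : 𝒜₀.Polarization D₀) {g₀ : ℕ} (lvl₀ : 𝒜₀.LevelStructure g₀ N')
    (twistIdeal : (Fi ≃ₐ[F] Fi) → Ideal (𝓞 F)) (N : ℕ) where
  /-- the NORM numbers of the twist ideals: `(twistNorm γ) = 𝔞_γ·𝔞̄_γ`. [cite: Shimura1998, §13.1, Theorem 1; §18.6] -/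
  twistNorm : (Fi ≃ₐ[F] Fi) → ℕ
  /-- `𝔞_γ·𝔞̄_γ = (n_γ)`. [cite: Shimura1998, §13.1, Theorem 1; §18.6] -/
  twistNorm_spec : ∀ γ : Fi ≃ₐ[F] Fi,
    Ideal.span {((twistNorm γ : ℕ) : 𝓞 F)} = twistIdeal γ * (IsCMField.complexConj F) • twistIdeal γ
  /-- the twist ideals are PRIME TO THE LEVEL `N`. [cite: Shimura1998, §18.6] -/
  twistIdeal_coprime : ∀ γ : Fi ≃ₐ[F] Fi, twistIdeal γ ⊔ Ideal.span {((N : ℕ) : 𝓞 F)} = ⊤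
  /-- **`A`-part: `𝒯(ℓ_e y) ≅ 𝒯(ℓ_{e∘γ} y) ⊗_{𝒪_F} 𝔞_γ` EXACTLY** (helper `CoverΩ`). [cite: Shimura1998, §13.1, Theorem 1; §18.6] [cite: RapoportSmithlingZhang2020Diagonal, §3.2 p. 11] -/
  cover : ∀ (γ : Fi ≃ₐ[F] Fi) (y : AlgPoints (S.M.obj Kc) (AlgebraicClosure (w.adicCompletion F))),
    CoverΩ S Kc 𝓜 w e 𝒜 ρ D pol lvl (e.comp (γ : Fi →ₐ[F] Fi)) (twistIdeal γ) (twistNorm γ) y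
  /-- **`A₀`-part: `𝒯₀(ℓ_e y) ≅ 𝒯₀(ℓ_{e∘γ} y) ⊗_{𝒪_F} 𝔞_γ`** with the SAME ideal and norm. [cite: Shimura1998, §13.1, Theorem 1; §18.6] [cite: RapoportSmithlingZhang2020Diagonal, §3.2 p. 11] -/
  cover_aux : ∀ (γ : Fi ≃ₐ[F] Fi) (y : AlgPoints (S.M.obj Kc) (AlgebraicClosure (w.adicCompletion F))),
    CoverΩ S Kc 𝓜 w e 𝒜₀ ρ₀ D₀ pol₀ lvl₀ (e.comp (γ : Fi →ₐ[F] Fi)) (twistIdeal γ) (twistNorm γ) y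

end Summit.HodgeConjecture.HodgeConjecture.Cruxes.HLiu418.F0P6aModuliDatumDefs
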